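import Mathlib
import HarnessLib
import Summits.HubbardSuperconductivity.HubbardSuperconductivity.Theorems.KLProgrammeKLRegimeEngineTowerBlockIncrLevOriented
import Summits.HubbardSuperconductivity.HubbardSuperconductivity.Theorems.KLProgrammeKLRegimeEngineTowerLevBridgeSwSigmaSucc
import Summits.HubbardSuperconductivity.HubbardSuperconductivity.Theorems.KLProgrammeKLRegimeEngineTowerLevFloorUnitsDefs

/-!
# (ℓ) located-risk #10 residual (b): THE ORIENTED DOOR'S LEVELLED DICTIONARY (I3) IN THE FLOOR CURRENCY, on the pin-credited input rows
# (crux K3 ENGINE, stmt-HubbardSuperconductivity-20437 `KLRegimeEngineV17F2`, stub (b) v2, levels package (ℓ); located «(ℓ)-LEV-INST-PINCREDIT»,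
#  KL STATUS 2026-08-28; cell gate-hubbard-kl, seat hubbard-kl-k3c2-p3 g14 — E1 / the LINK-F lane may rename or supersede)

k3c2-p3's oriented door `blockStep_ordersGe2_wtOriented_le` leaves to the tower the levelled majorant (I3): `Nl m Lv ≥ 0` antitone in the level `Lv`
(= number of known sectors at the vertex), with `ε·B (m′+1) Fc ≤ Nl (m′+1) (Fc+1)` (full pin, `|E| = Fc+1`), `ε·B′ (m′+1) Fc ≤ Nl (m′+1) Fc` (position-only
pin, `|E| = Fc`) and `Nl m Lv ≤ Bm m·θ^{lumps Lv}` (`Lv ≥ 1`).  With the input families keyed on the pin-CREDITED bridges (…TowerLevBridgeSucc,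
…TowerLevBridgeSwSigmaSucc) —

  `B m Fc := klTowerMeasLev … (2m) (Fc = 0 ? 0 : Fc + 1)`,  `B′ m Fc := (Fc = 0 ? |Σ|·klTowerMeasLev … (2m) 0 : klTowerMeasLev … (2m) Fc)`

(level `0` kept at the pinned-leg-only rows so that the door guard and flat tail stay in the landed currency `normV (ε·klTowerMeasLev … (2m′) 0)`; levels `0`
and `1` coincide in positive degree, `klTowerMeasLev_zero_eq_one`) — the dictionary is DISCHARGED OUTRIGHT in k3c2-p3's floor units (…TowerLevFloorUnitsDefs):

  `Nl m Lv := ε·(Lv = 0 ? |Σ|·klTowerMeasLev (2m) 0 : klTowerMeasLev (2m) Lv)`,  `θ := (1/2)^{dk−1}`,  `Bm m := ε·klTowerMuLevF … d k m·klLevUnitF β M 0 m (dk−1)/27`.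

* `klLevGain_eq_lumps` (`rfl`), `klLevUnitF_eq_zero_track_div`, **`imagTimeWeight_mul_klTowerMeasLev_le_floor`** (the `hdom` inequality: unfold
  `klTowerMuLevAtF t ≤ klTowerMuLevF` at the track `t = (Lv ∧ 5) − 1`, split the unit, fold levels `≥ 6` into `5` by `klTowerMeasLev_anti`);
* the lambda rows `towerBF_zero/_succ`, `towerBswF_zero/_succ`, `towerNlF_zero/_succ/_nonneg/_anti`, the (I2) rows `stdInput_klTowerInput_le_towerBF`,
  `swInput_klTowerInput_le_towerBswF`, and the (I3) rows `towerBF_le_towerNlF` (`hBN`), `towerBswF_le_towerNlF` (`hB′N`), `towerNlF_le_floor` (`hdom`).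
The re-keyed door instance with (I3) discharged is …TowerBlockIncrLevOrientedF.  Proofs only (families spelled as lambdas, no definitions); nothing about the
model is asserted; nothing asserts (ℓ), any stub, K3 or superconductivity.
References: BGM 2006 §2.8 (2.76)–(2.77), (2.88)–(2.90), (2.97)–(2.98), Lemma 2.5, App. A4 (A4.2), (A4.8) [cite: BenfattoGiulianiMastropietro2006].
-/

noncomputable section

namespace Summit.HubbardSuperconductivity.HubbardSuperconductivity.Theorems.EngineV8

set_option linter.dupNamespace false -- summit = problem name (single-conjunct summit), D-0017

open Classical
open Real Finset Literature.MathematicalPhysics.QuantumLattice Literature.Probability.LatticeModels GrassmannAlgebra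
open Literature.MathematicalPhysics.QuantumLattice.FermiRG Literature.MathematicalPhysics.QuantumLattice.FermiRG.BGM2006Routing
open Summit.HubbardSuperconductivity.HubbardSuperconductivity.Theorems.KLProgrammeLegKernels
open Summit.HubbardSuperconductivity.HubbardSuperconductivity.Theorems.KLRegimeSplit
open Summit.HubbardSuperconductivity.HubbardSuperconductivity.Theorems.KLRegimeWick
open Summit.HubbardSuperconductivity.HubbardSuperconductivity.Theorems.TwoPointAssembly
open scoped Nat

variable {L M : ℕ} [NeZero L] [NeZero M]

/-! ## §1 The (I3) dictionary in the floor currency -/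

omit [NeZero L] [NeZero M] in
/-- The floor gain of track `t` IS the lump count of level `t + 1` (`rfl`). -/
theorem klLevGain_eq_lumps (t : Fin 5) : klLevGain t = lumps ((t : ℕ) + 1) := rfl

omit [NeZero L] [NeZero M] in
/-- **Splitting the floor unit**: `klLevUnitF β M t p J = klLevUnitF β M 0 p J / 2^{klLevGain t·J}`. -/
theorem klLevUnitF_eq_zero_track_div (β : ℝ) (M : ℕ) (t : Fin 5) (p J : ℕ) :
    klLevUnitF β M t p J = klLevUnitF β M 0 p J / (2 : ℝ) ^ (klLevGain t * J) := by
  unfold klLevUnitF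
  have h0 : klLevGain 0 * J = 0 := by rw [show klLevGain 0 = 0 from rfl, zero_mul]
  rw [h0, pow_zero, mul_one, div_div]

omit [NeZero L] [NeZero M] in
/-- `1/2^{g·J} = ((1/2)^J)^g`. -/
theorem inv_two_pow_mul_eq (g J : ℕ) : ((2 : ℝ) ^ (g * J))⁻¹ = ((1 / 2 : ℝ) ^ J) ^ g := by
  rw [← pow_mul, mul_comm J g, one_div, inv_pow]

/-- **THE `hdom` ROW IN FLOOR UNITS.**  For `1 ≤ Lv`: `ε·klTowerMeasLev … d k (2m) Lv ≤ (ε·klTowerMuLevF … d k m·klLevUnitF β M 0 m (dk−1)/27)·((1/2)^{dk−1})^{lumps Lv}`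
(`0 < β`): at `Lv = t+1 ≤ 5` this is `klTowerMuLevAtF t ≤ klTowerMuLevF` with the unit split `klLevUnitF t = klLevUnitF 0·((1/2)^{dk−1})^{klLevGain t}` and
`27 ≤ 27^{t+1}`; levels `≥ 6` are folded into level `5` (`klTowerMeasLev_anti`, `lumps = 2` from `5` on). -/
theorem imagTimeWeight_mul_klTowerMeasLev_le_floor {β : ℝ} (hβ : 0 < β) (U μ : ℝ) (K : TrigPolyC4v) (d k m : ℕ) {Lv : ℕ} (hLv : 1 ≤ Lv) :
    imagTimeWeight β M * klTowerMeasLev L M β U μ K d k (2 * m) Lv ≤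
      (imagTimeWeight β M * klTowerMuLevF L M β U μ K d k m * klLevUnitF β M 0 m (d * k - 1) / 27) * ((1 / 2 : ℝ) ^ (d * k - 1)) ^ lumps Lv := by
  have hε : 0 ≤ imagTimeWeight β M := imagTimeWeight_nonneg hβ.le M
  -- fold the level into `Lv ∧ 5`
  set Lv' := min Lv 5 with hLv'
  have hle : klTowerMeasLev L M β U μ K d k (2 * m) Lv ≤ klTowerMeasLev L M β U μ K d k (2 * m) Lv' :=
    klTowerMeasLev_anti hβ.le U μ K d k (2 * m) (min_le_left Lv 5)
  have hlumps : lumps Lv = lumps Lv' := by simp only [lumps, hLv']; omega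
  -- the track `t = Lv' − 1`
  have ht5 : Lv' - 1 < 5 := by omega
  set t : Fin 5 := ⟨Lv' - 1, ht5⟩ with ht
  have htL : (t : ℕ) + 1 = Lv' := by simp only [ht]; omega
  have hU0 : 0 < klLevUnitF β M t m (d * k - 1) := klLevUnitF_pos hβ t m _
  -- `klTowerMuLevAtF t ≤ klTowerMuLevF`, unfolded
  have hAt := klTowerMuLevAtF_le_klTowerMuLevF (L := L) (M := M) β U μ K d t k m
  unfold klTowerMuLevAtF at hAt
  rw [div_le_iff₀ hU0, htL] at hAt
  -- `27^{t+1}·MeasLev Lv' ≤ MuLevF·U_t`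
  have hF0 : 0 ≤ klTowerMuLevF L M β U μ K d k m := klTowerMuLevF_nonneg hβ U μ K d k m
  have hMeas : klTowerMeasLev L M β U μ K d k (2 * m) Lv' ≤ klTowerMuLevF L M β U μ K d k m * klLevUnitF β M t m (d * k - 1) / 27 := by
    rw [le_div_iff₀ (by norm_num : (0 : ℝ) < 27)]
    calc klTowerMeasLev L M β U μ K d k (2 * m) Lv' * 27
        ≤ klTowerMeasLev L M β U μ K d k (2 * m) Lv' * (27 : ℝ) ^ Lv' := by
          refine mul_le_mul_of_nonneg_left ?_ (klTowerMeasLev_nonneg hβ.le U μ K d k _ _)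
          calc (27 : ℝ) = 27 ^ 1 := (pow_one _).symm
            _ ≤ 27 ^ Lv' := pow_le_pow_right₀ (by norm_num) (by omega)
      _ = (27 : ℝ) ^ Lv' * klTowerMeasLev L M β U μ K d k (2 * m) Lv' := mul_comm _ _
      _ ≤ klTowerMuLevF L M β U μ K d k m * klLevUnitF β M t m (d * k - 1) := hAt
  -- split the unit
  rw [klLevUnitF_eq_zero_track_div, klLevGain_eq_lumps, htL] at hMeas
  rw [hlumps]
  calc imagTimeWeight β M * klTowerMeasLev L M β U μ K d k (2 * m) Lv
      ≤ imagTimeWeight β M * klTowerMeasLev L M β U μ K d k (2 * m) Lv' := mul_le_mul_of_nonneg_left hle hε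
    _ ≤ imagTimeWeight β M * (klTowerMuLevF L M β U μ K d k m * (klLevUnitF β M 0 m (d * k - 1) / (2 : ℝ) ^ (lumps Lv' * (d * k - 1))) / 27) :=
        mul_le_mul_of_nonneg_left hMeas hε
    _ = (imagTimeWeight β M * klTowerMuLevF L M β U μ K d k m * klLevUnitF β M 0 m (d * k - 1) / 27) * ((1 / 2 : ℝ) ^ (d * k - 1)) ^ lumps Lv' := by
        rw [← inv_two_pow_mul_eq, div_eq_mul_inv (klLevUnitF β M 0 m (d * k - 1))]
        ring

omit [NeZero M] in
/-- The full-pin input family, pin-credited with the level-`0` row kept: its value at level `0`. -/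
theorem towerBF_zero (β U μ : ℝ) (K : TrigPolyC4v) (d k m : ℕ) :
    (fun m c : ℕ => if c = 0 then klTowerMeasLev L M β U μ K d k (2 * m) 0 else klTowerMeasLev L M β U μ K d k (2 * m) (c + 1)) m 0 =
      klTowerMeasLev L M β U μ K d k (2 * m) 0 := by
  simp only [if_true]

omit [NeZero M] in
/-- The full-pin input family at a successor level-count reads the array TWO levels up (`|E| = F₀ + 2` known sectors). -/
theorem towerBF_succ (β U μ : ℝ) (K : TrigPolyC4v) (d k m F₀ : ℕ) :
    (fun m c : ℕ => if c = 0 then klTowerMeasLev L M β U μ K d k (2 * m) 0 else klTowerMeasLev L M β U μ K d k (2 * m) (c + 1)) m (F₀ + 1) =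
      klTowerMeasLev L M β U μ K d k (2 * m) (F₀ + 1 + 1) := by
  simp only [Nat.succ_ne_zero, if_false]

omit [NeZero M] in
/-- The pin-credited position-only family: level `0`. -/
theorem towerBswF_zero (β U μ : ℝ) (K : TrigPolyC4v) (d k m : ℕ) :
    (fun m Fc : ℕ => if Fc = 0 then (Fintype.card (SectorLeg (sectorCount (d * k - 1))) : ℝ) * klTowerMeasLev L M β U μ K d k (2 * m) 0
      else klTowerMeasLev L M β U μ K d k (2 * m) Fc) m 0 =
      (Fintype.card (SectorLeg (sectorCount (d * k - 1))) : ℝ) * klTowerMeasLev L M β U μ K d k (2 * m) 0 := by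
  simp only [if_true]

omit [NeZero M] in
/-- The pin-credited position-only family: successor levels read the array AT the level. -/
theorem towerBswF_succ (β U μ : ℝ) (K : TrigPolyC4v) (d k m F₀ : ℕ) :
    (fun m Fc : ℕ => if Fc = 0 then (Fintype.card (SectorLeg (sectorCount (d * k - 1))) : ℝ) * klTowerMeasLev L M β U μ K d k (2 * m) 0
      else klTowerMeasLev L M β U μ K d k (2 * m) Fc) m (F₀ + 1) = klTowerMeasLev L M β U μ K d k (2 * m) (F₀ + 1) := by
  simp only [Nat.succ_ne_zero, if_false]

/-- **(I2), full pin, pin-credited**: for `q ∈ E`, `|E| = Fc + 1`, the unweighted input sum of `𝒱_{dk}` at `F_{dk−1}` in degree `2m′+2` is at most the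
pin-credited full-pin family at `(m′+1, Fc)` (`0 < β`). -/
theorem stdInput_klTowerInput_le_towerBF {β : ℝ} (hβ : 0 < β) (U μ : ℝ) (K : TrigPolyC4v) (d k : ℕ) (m' Fc : ℕ)
    (E : Finset (Fin (2 * m' + 1 + 1))) (τ : Fin (2 * m' + 1 + 1) → SectorLeg (sectorCount (d * k - 1))) (q : Fin (2 * m' + 1 + 1))
    (hq : q ∈ E) (hE : E.card = Fc + 1) (y : SpaceTimeIdx L M) :
    imagTimeWeight β M ^ (2 * m' + 1) *
        ∑ σ ∈ univ.filter (fun σ : Fin (2 * m' + 1 + 1) → SectorLeg (sectorCount (d * k - 1)) => ∀ e ∈ E, σ e = τ e),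
          ∑ x ∈ univ.filter (fun x : Fin (2 * m' + 1 + 1) → SpaceTimeIdx L M => x q = y),
            ‖sectorisedKernel L M β (klAnisoFamily L M β μ K klE0 (d * k - 1)) (klTowerInput L M β U μ K d k) (2 * m' + 1 + 1) σ x‖ ≤
      (fun m c : ℕ => if c = 0 then klTowerMeasLev L M β U μ K d k (2 * m) 0 else klTowerMeasLev L M β U μ K d k (2 * m) (c + 1)) (m' + 1) Fc := by
  rcases Fc with _ | F₀
  · rw [towerBF_zero]
    exact doorInput_klTowerInput_le_klTowerMeasLev hβ.le U μ K d k m' 0 E τ q hq hE y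
  · rw [towerBF_succ]
    exact doorInput_klTowerInput_le_klTowerMeasLev_succ hβ.le U μ K d k m' (F₀ + 1) E τ q hq hE y

/-- **(I2), position-only pin, pin-credited**: for `t ∉ E`, `|E| = Fc`, ANY choice `yσ` of the pinned position per sector of the pinned leg, the unweighted
swapped input sum of `𝒱_{dk}` at `F_{dk−1}` in degree `2m′+2` is at most the pin-credited position-only family at `(m′+1, Fc)` (`0 < β`). -/
theorem swInput_klTowerInput_le_towerBswF {β : ℝ} (hβ : 0 < β) (U μ : ℝ) (K : TrigPolyC4v) (d k : ℕ) (m' Fc : ℕ)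
    (E : Finset (Fin (2 * m' + 1 + 1))) (τ : Fin (2 * m' + 1 + 1) → SectorLeg (sectorCount (d * k - 1))) (t : Fin (2 * m' + 1 + 1))
    (hE : E.card = Fc) (yσ : SectorLeg (sectorCount (d * k - 1)) → SpaceTimeIdx L M) :
    imagTimeWeight β M ^ (2 * m' + 1) *
        ∑ σ ∈ univ.filter (fun σ : Fin (2 * m' + 1 + 1) → SectorLeg (sectorCount (d * k - 1)) => ∀ e ∈ E, σ e = τ e),
          ∑ x ∈ univ.filter (fun x : Fin (2 * m' + 1 + 1) → SpaceTimeIdx L M => x t = yσ (σ t)),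
            ‖sectorisedKernel L M β (klAnisoFamily L M β μ K klE0 (d * k - 1)) (klTowerInput L M β U μ K d k) (2 * m' + 1 + 1) σ x‖ ≤
      (fun m Fc : ℕ => if Fc = 0 then (Fintype.card (SectorLeg (sectorCount (d * k - 1))) : ℝ) * klTowerMeasLev L M β U μ K d k (2 * m) 0
        else klTowerMeasLev L M β U μ K d k (2 * m) Fc) (m' + 1) Fc := by
  have h2 : 2 * (m' + 1) = 2 * m' + 1 + 1 := by ring
  rcases Fc with _ | F₀
  · rw [towerBswF_zero, h2]
    exact swSigmaInput_klTowerInput_levelZero_le hβ.le U μ K d k E τ t hE yσ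
  · rw [towerBswF_succ, h2]
    exact swSigmaInput_klTowerInput_le_klTowerMeasLev_succ hβ U μ K d k E τ t hE yσ

omit [NeZero M] in
/-- The floor majorant `Nl`: level `0`. -/
theorem towerNlF_zero (β U μ : ℝ) (K : TrigPolyC4v) (d k m : ℕ) :
    (fun m Lv : ℕ => imagTimeWeight β M * (if Lv = 0 then (Fintype.card (SectorLeg (sectorCount (d * k - 1))) : ℝ) *
        klTowerMeasLev L M β U μ K d k (2 * m) 0 else klTowerMeasLev L M β U μ K d k (2 * m) Lv)) m 0 =
      imagTimeWeight β M * ((Fintype.card (SectorLeg (sectorCount (d * k - 1))) : ℝ) * klTowerMeasLev L M β U μ K d k (2 * m) 0) := by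
  simp only [if_true]

omit [NeZero M] in
/-- The floor majorant `Nl`: positive levels. -/
theorem towerNlF_succ (β U μ : ℝ) (K : TrigPolyC4v) (d k m F₀ : ℕ) :
    (fun m Lv : ℕ => imagTimeWeight β M * (if Lv = 0 then (Fintype.card (SectorLeg (sectorCount (d * k - 1))) : ℝ) *
        klTowerMeasLev L M β U μ K d k (2 * m) 0 else klTowerMeasLev L M β U μ K d k (2 * m) Lv)) m (F₀ + 1) =
      imagTimeWeight β M * klTowerMeasLev L M β U μ K d k (2 * m) (F₀ + 1) := by
  simp only [Nat.succ_ne_zero, if_false]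

omit [NeZero M] in
/-- The floor majorant is nonnegative (`0 < β`). -/
theorem towerNlF_nonneg {β : ℝ} (hβ : 0 < β) (U μ : ℝ) (K : TrigPolyC4v) (d k m Lv : ℕ) :
    0 ≤ (fun m Lv : ℕ => imagTimeWeight β M * (if Lv = 0 then (Fintype.card (SectorLeg (sectorCount (d * k - 1))) : ℝ) *
        klTowerMeasLev L M β U μ K d k (2 * m) 0 else klTowerMeasLev L M β U μ K d k (2 * m) Lv)) m Lv := by
  have hε : 0 ≤ imagTimeWeight β M := imagTimeWeight_nonneg hβ.le M
  rcases Lv with _ | F₀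
  · rw [towerNlF_zero]
    exact mul_nonneg hε (mul_nonneg (Nat.cast_nonneg _) (klTowerMeasLev_nonneg hβ.le U μ K d k _ _))
  · rw [towerNlF_succ]
    exact mul_nonneg hε (klTowerMeasLev_nonneg hβ.le U μ K d k _ _)

omit [NeZero M] in
/-- **The floor majorant is antitone in the level** (`klTowerMeasLev_anti`; at level `0` the extra factor `|Σ| ≥ 1`). -/
theorem towerNlF_anti {β : ℝ} (hβ : 0 < β) (U μ : ℝ) (K : TrigPolyC4v) (d k m : ℕ) {Lv Lv' : ℕ} (h : Lv ≤ Lv') :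
    (fun m Lv : ℕ => imagTimeWeight β M * (if Lv = 0 then (Fintype.card (SectorLeg (sectorCount (d * k - 1))) : ℝ) *
        klTowerMeasLev L M β U μ K d k (2 * m) 0 else klTowerMeasLev L M β U μ K d k (2 * m) Lv)) m Lv' ≤
      (fun m Lv : ℕ => imagTimeWeight β M * (if Lv = 0 then (Fintype.card (SectorLeg (sectorCount (d * k - 1))) : ℝ) *
        klTowerMeasLev L M β U μ K d k (2 * m) 0 else klTowerMeasLev L M β U μ K d k (2 * m) Lv)) m Lv := by
  have hε : 0 ≤ imagTimeWeight β M := imagTimeWeight_nonneg hβ.le M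
  rcases Lv' with _ | F₀'
  · have h0 : Lv = 0 := Nat.le_zero.1 h
    subst h0
    exact le_rfl
  rw [towerNlF_succ]
  rcases Lv with _ | F₀
  · rw [towerNlF_zero]
    refine mul_le_mul_of_nonneg_left ?_ hε
    have hcard : (1 : ℝ) ≤ (Fintype.card (SectorLeg (sectorCount (d * k - 1))) : ℝ) := by
      have : 0 < Fintype.card (SectorLeg (sectorCount (d * k - 1))) :=
        Fintype.card_pos_iff.2 ⟨((⟨0, sectorCount_pos _⟩, 0), 0)⟩
      exact_mod_cast this
    calc klTowerMeasLev L M β U μ K d k (2 * m) (F₀' + 1)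
        ≤ klTowerMeasLev L M β U μ K d k (2 * m) 0 := klTowerMeasLev_anti hβ.le U μ K d k (2 * m) (Nat.zero_le _)
      _ = 1 * klTowerMeasLev L M β U μ K d k (2 * m) 0 := (one_mul _).symm
      _ ≤ (Fintype.card (SectorLeg (sectorCount (d * k - 1))) : ℝ) * klTowerMeasLev L M β U μ K d k (2 * m) 0 :=
          mul_le_mul_of_nonneg_right hcard (klTowerMeasLev_nonneg hβ.le U μ K d k _ _)
  · rw [towerNlF_succ]
    exact mul_le_mul_of_nonneg_left (klTowerMeasLev_anti hβ.le U μ K d k (2 * m) h) hε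

omit [NeZero M] in
/-- **The `hBN` row, pin-credited**: `ε·B (m′+1) Fc ≤ Nl (m′+1) (Fc+1)` — an equality at `Fc ≥ 1`, and `klTowerMeasLev_zero_le_one` at `Fc = 0`. -/
theorem towerBF_le_towerNlF {β : ℝ} (hβ : 0 < β) (U μ : ℝ) (K : TrigPolyC4v) (d k m' Fc : ℕ) :
    imagTimeWeight β M *
        (fun m c : ℕ => if c = 0 then klTowerMeasLev L M β U μ K d k (2 * m) 0 else klTowerMeasLev L M β U μ K d k (2 * m) (c + 1)) (m' + 1) Fc ≤
      (fun m Lv : ℕ => imagTimeWeight β M * (if Lv = 0 then (Fintype.card (SectorLeg (sectorCount (d * k - 1))) : ℝ) *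
        klTowerMeasLev L M β U μ K d k (2 * m) 0 else klTowerMeasLev L M β U μ K d k (2 * m) Lv)) (m' + 1) (Fc + 1) := by
  have hε : 0 ≤ imagTimeWeight β M := imagTimeWeight_nonneg hβ.le M
  have h2 : 2 * (m' + 1) = 2 * m' + 1 + 1 := by ring
  rw [towerNlF_succ]
  rcases Fc with _ | F₀
  · rw [towerBF_zero, h2]
    exact mul_le_mul_of_nonneg_left (klTowerMeasLev_zero_le_one hβ.le U μ K d k (2 * m' + 1)) hε
  · rw [towerBF_succ]

omit [NeZero M] in
/-- **The `hB′N` row, pin-credited**: `ε·B′ (m′+1) Fc ≤ Nl (m′+1) Fc` (equalities). -/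
theorem towerBswF_le_towerNlF (β U μ : ℝ) (K : TrigPolyC4v) (d k m' Fc : ℕ) :
    imagTimeWeight β M *
        (fun m Fc : ℕ => if Fc = 0 then (Fintype.card (SectorLeg (sectorCount (d * k - 1))) : ℝ) * klTowerMeasLev L M β U μ K d k (2 * m) 0
          else klTowerMeasLev L M β U μ K d k (2 * m) Fc) (m' + 1) Fc ≤
      (fun m Lv : ℕ => imagTimeWeight β M * (if Lv = 0 then (Fintype.card (SectorLeg (sectorCount (d * k - 1))) : ℝ) *
        klTowerMeasLev L M β U μ K d k (2 * m) 0 else klTowerMeasLev L M β U μ K d k (2 * m) Lv)) (m' + 1) Fc := by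
  rcases Fc with _ | F₀
  · rw [towerBswF_zero, towerNlF_zero]
  · rw [towerBswF_succ, towerNlF_succ]

/-- **The `hdom` row for the floor majorant**: `1 ≤ Lv → Nl m′ Lv ≤ Bm m′ · θ^{lumps Lv}` with `Bm m′ := ε·klTowerMuLevF … m′·klLevUnitF β M 0 m′ (dk−1)/27`,
`θ := (1/2)^{dk−1}` (`0 < β`). -/
theorem towerNlF_le_floor {β : ℝ} (hβ : 0 < β) (U μ : ℝ) (K : TrigPolyC4v) (d k m' : ℕ) {Lv : ℕ} (hLv : 1 ≤ Lv) :
    (fun m Lv : ℕ => imagTimeWeight β M * (if Lv = 0 then (Fintype.card (SectorLeg (sectorCount (d * k - 1))) : ℝ) *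
        klTowerMeasLev L M β U μ K d k (2 * m) 0 else klTowerMeasLev L M β U μ K d k (2 * m) Lv)) m' Lv ≤
      (fun m : ℕ => imagTimeWeight β M * klTowerMuLevF L M β U μ K d k m * klLevUnitF β M 0 m (d * k - 1) / 27) m' *
        ((1 / 2 : ℝ) ^ (d * k - 1)) ^ lumps Lv := by
  obtain ⟨F₀, rfl⟩ : ∃ F₀, Lv = F₀ + 1 := ⟨Lv - 1, by omega⟩
  rw [towerNlF_succ]
  exact imagTimeWeight_mul_klTowerMeasLev_le_floor hβ U μ K d k m' hLv


end Summit.HubbardSuperconductivity.HubbardSuperconductivity.Theorems.EngineV8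

end
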